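import Mathlib
import HarnessLib
import Summits.NavierStokesRegularity.NavierStokesRegularity.Theorems.CompletionRelayChainRelayFrontStepTailProfile
import Summits.NavierStokesRegularity.NavierStokesRegularity.Theorems.CompletionRelayChainRelayFrontStepTailStep

/-!
# `CompletionRelayChain` — crux `RelayFrontStep` (item stmt-NavierStokesRegularity-24850):
  registered stub `stub_tail` of LINE `window_v2` — THE FAR TAIL

Along any `(η,η)`-pseudo-flow of a table in `E₂(64)` with the completion-relay rows, started in the
repaired window `W₂` (far-ahead energy clauses `F₀ i k ≤ aheadE k`, idle clauses `F₀ 3 k ≤ idleE k`),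
and given on the hop window `[0, τ₁]` (`τ₁ ≤ 8`) the time-integrated bounds `∫u₂² ≤ 1e-11`,
`∫|r₂u₂| ≤ 1e-13` on old shell 2's trigger and relay (outputs of the front block), the energies of all
old shells `k ≥ 4` stay under the epoch envelope `relayEnv₂` and the far-ahead energy clauses re-enter
after rescaling by any amplitude ratio `a ≥ 17/20` (`stub_tail`, registered signature verbatim).

PROOF (profile arithmetic in `…RelayFrontStepTailProfile`). Shell 3: `relay_tail_step` with the
relay-flux weight of shell 2 itself ⇒ `√(Σᵢ F_{i,3}) ≤ √Est 3 + 16√2(∫u₂² + ∫|r₂u₂|/32) ≤ 2.45e-10`,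
so `Σᵢ F_{i,3} ≤ 6e-20` on `[0, τ₁]`. Shells `K ≥ 4`: by induction (`relay_tail_step_of_energy_le`),
`Σᵢ F_{i,K} ≤ 9·Est K` on `[0, τ₁]` (base `K = 4` from the shell-3 bound with `2^{15/2} ≤ 181.1`;
step by `2^{5K/2}·P K ≤ 2^{−26}`). Conclusions: `9·Est K ≤ relayEnv₂ K` and
`9·Est(1+k)/a² ≤ aheadE k` for `a ≥ 17/20`.

HONEST FRAMING: MODEL lattice only (Tao 2016 §4 vocabulary); one registered stub of an open crux; the
crux `RelayFrontStep`, the rung TL-M3-R64 and every NS statement remain unproved. Nothing here is a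
statement about the Navier–Stokes equations.
-/

noncomputable section

-- the summit-side namespace `Summit.NavierStokesRegularity.NavierStokesRegularity.…` (single-conjunct summit,
-- D-0017) repeats a component by design; the dupNamespace linter would flag every declaration.
set_option linter.dupNamespace false

open Set MeasureTheory intervalIntegral Literature.Analysis.FluidPDE Literature.Analysis.FluidPDE.TaoCascade
open Summit.NavierStokesRegularity.NavierStokesRegularity.Theorems
open Summit.NavierStokesRegularity.NavierStokesRegularity.Theorems.RelayFrontStep

namespace Summit.NavierStokesRegularity.NavierStokesRegularity.Cruxes.RelayFrontStep.Window2

/-! ### The flow part -/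

variable {τ κ₁ κ₂ : ℝ} {α : Fin 4 → Fin 4 → Fin 4 → ℤ × ℤ × ℤ → ℝ}
  {S₀ F₀ B₀ : Fin 4 → ℤ → ℝ} {S F : Fin 4 → ℤ → ℝ → ℝ}

/-- **Old shell 3 over the hop**: `Σᵢ F_{i,3}(s) ≤ 6e-20` on `[0, τ₁]`, from the time-integrated
relay-flux weight of old shell 2 (`∫u₂² ≤ 1e-11`, `∫|r₂u₂| ≤ 1e-13`) and the start energies above
shell 3. [this file] -/
theorem shell_three_le (h : PseudoFlowOn τ 1 α κ₁ κ₂ S₀ F₀ B₀ S F) (hτ : 0 < τ)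
    (hα : IsCancellingCoeff α) (hrows : RelayRows α)
    (hahead : ∀ k : ℤ, 2 ≤ k → ∀ i : Fin 4, i ≠ 3 → F₀ i k ≤ aheadE k)
    (hidle : ∀ k : ℤ, F₀ 3 k ≤ idleE k) {τ₁ : ℝ} (hτ₁ : τ₁ ∈ Icc 0 τ)
    (hI1 : (∫ s in (0 : ℝ)..τ₁, S 1 2 s ^ 2) ≤ 1 / 10 ^ 11)
    (hI2 : (∫ s in (0 : ℝ)..τ₁, |S 2 2 s * S 1 2 s|) ≤ 1 / 10 ^ 13) :
    ∀ s ∈ Icc 0 τ₁, ∑ i, F i 3 s ≤ 6 / 10 ^ 20 := by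
  have hsub : Icc 0 τ₁ ⊆ Icc 0 τ := Icc_subset_Icc_right hτ₁.2
  have hS : ∀ i n, ContinuousOn (S i n) (Icc 0 τ₁) :=
    fun i n => (h.contDiffOn_S i n).continuousOn.mono hsub
  -- the weight of old shell 2
  set g : ℝ → ℝ := fun u => 32 * (S 1 2 u ^ 2 + |S 2 2 u * S 1 2 u| / 32) with hg
  have hg_cont : ContinuousOn g (Icc 0 τ₁) :=
    continuousOn_const.mul (((hS 1 2).pow 2).add (((hS 2 2).mul (hS 1 2)).abs.div_const 32))
  have hflux : ∀ u ∈ Icc 0 τ₁,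
      (1 + 1 : ℝ) ^ ((5 : ℝ) * (((3 - 1 : ℤ) : ℝ)) / 2) *
        (S 1 (3 - 1) u ^ 2 + |S 2 (3 - 1) u * S 1 (3 - 1) u| / 32) ≤ g u := by
    intro u _
    rw [clock_two, show (3 - 1 : ℤ) = 2 by norm_num]
  have hstep := relay_tail_step h hτ hα hrows 3 (est_nonneg 3)
    (tail_start_le hahead hidle (by norm_num)) hτ₁ hg_cont hflux
  intro s hs
  -- the integral of the weight
  have hs1 : uIcc 0 s ⊆ Icc 0 τ₁ := by rw [uIcc_of_le hs.1]; exact Icc_subset_Icc_right hs.2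
  have hi1 : IntervalIntegrable (fun u => S 1 2 u ^ 2) volume 0 τ₁ :=
    (((hS 1 2).pow 2).mono (by rw [uIcc_of_le hτ₁.1])).intervalIntegrable
  have hi2 : IntervalIntegrable (fun u => |S 2 2 u * S 1 2 u|) volume 0 τ₁ :=
    ((((hS 2 2).mul (hS 1 2)).abs).mono (by rw [uIcc_of_le hτ₁.1])).intervalIntegrable
  have hi1s : IntervalIntegrable (fun u => S 1 2 u ^ 2) volume 0 s :=
    (((hS 1 2).pow 2).mono hs1).intervalIntegrable
  have hi2s : IntervalIntegrable (fun u => |S 2 2 u * S 1 2 u|) volume 0 s :=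
    ((((hS 2 2).mul (hS 1 2)).abs).mono hs1).intervalIntegrable
  have hm1 : (∫ u in (0 : ℝ)..s, S 1 2 u ^ 2) ≤ 1 / 10 ^ 11 :=
    (intervalIntegral.integral_mono_interval le_rfl hs.1 hs.2
      (Filter.Eventually.of_forall fun u => sq_nonneg _) hi1).trans hI1
  have hm2 : (∫ u in (0 : ℝ)..s, |S 2 2 u * S 1 2 u|) ≤ 1 / 10 ^ 13 :=
    (intervalIntegral.integral_mono_interval le_rfl hs.1 hs.2
      (Filter.Eventually.of_forall fun u => abs_nonneg _) hi2).trans hI2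
  have hint : (∫ u in (0 : ℝ)..s, Real.sqrt 2 * g u) =
      Real.sqrt 2 * 32 * ((∫ u in (0 : ℝ)..s, S 1 2 u ^ 2) +
        (1 / 32) * ∫ u in (0 : ℝ)..s, |S 2 2 u * S 1 2 u|) := by
    have : (fun u => Real.sqrt 2 * g u) =
        fun u => Real.sqrt 2 * 32 * (S 1 2 u ^ 2 + (1 / 32) * |S 2 2 u * S 1 2 u|) := by
      funext u; simp only [hg]; ring
    rw [this, intervalIntegral.integral_const_mul, intervalIntegral.integral_add hi1s (hi2s.const_mul _),
      intervalIntegral.integral_const_mul]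
  have hsq := hstep s hs
  rw [hint] at hsq
  -- numerics
  have h3 := sqrt_est_three_le
  have hn1 : 0 ≤ ∫ u in (0 : ℝ)..s, S 1 2 u ^ 2 :=
    intervalIntegral.integral_nonneg hs.1 (fun u _ => sq_nonneg (S 1 2 u))
  have hn2 : 0 ≤ ∫ u in (0 : ℝ)..s, |S 2 2 u * S 1 2 u| :=
    intervalIntegral.integral_nonneg hs.1 (fun u _ => abs_nonneg (S 2 2 u * S 1 2 u))
  have hroot : Real.sqrt (∑ i, F i 3 s) ≤ 2449 / 10 ^ 13 := by
    nlinarith [sqrt_two_le, Real.sqrt_nonneg 2, mul_nonneg (Real.sqrt_nonneg 2) hn1,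
      mul_nonneg (Real.sqrt_nonneg 2) hn2]
  have hnn : 0 ≤ ∑ i, F i 3 s := Finset.sum_nonneg fun i _ => h.nonneg_F i 3 s (hsub hs)
  have := Real.sqrt_le_left (by norm_num) |>.mp hroot
  linarith [show ((2449 : ℝ) / 10 ^ 13) ^ 2 ≤ 6 / 10 ^ 20 by norm_num]

/-- **Old shell 4 over the hop** (base of the induction): `Σᵢ F_{i,4}(s) ≤ 9·Est 4` on `[0, τ₁]`
(`τ₁ ≤ 8`), from the shell-3 bound and `2^{15/2} ≤ 181.1`. [this file] -/
theorem shell_four_le (h : PseudoFlowOn τ 1 α κ₁ κ₂ S₀ F₀ B₀ S F) (hτ : 0 < τ)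
    (hα : IsCancellingCoeff α) (hrows : RelayRows α)
    (hahead : ∀ k : ℤ, 2 ≤ k → ∀ i : Fin 4, i ≠ 3 → F₀ i k ≤ aheadE k)
    (hidle : ∀ k : ℤ, F₀ 3 k ≤ idleE k) {τ₁ : ℝ} (hτ₁ : τ₁ ∈ Icc 0 τ) (hτ₁8 : τ₁ ≤ 8)
    (h3 : ∀ s ∈ Icc 0 τ₁, ∑ i, F i 3 s ≤ 6 / 10 ^ 20) :
    ∀ s ∈ Icc 0 τ₁, ∑ i, F i 4 s ≤ 9 * (2 * (3 * aheadE 4 + idleE 4)) := by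
  have hsub : Icc 0 τ₁ ⊆ Icc 0 τ := Icc_subset_Icc_right hτ₁.2
  intro s hs
  have hstep := relay_tail_step_of_energy_le h hτ hα hrows 4 (est_nonneg 4)
    (tail_start_le hahead hidle (by norm_num)) hτ₁ (β := 6 / 10 ^ 20)
    (fun u hu => by rw [show (4 - 1 : ℤ) = 3 by norm_num]; exact h3 u hu) s hs
  have hΛ := clock_three_le
  have hΛ0 : 0 ≤ (1 + 1 : ℝ) ^ ((5 : ℝ) * (((4 - 1 : ℤ) : ℝ)) / 2) :=
    (Real.rpow_pos_of_pos (by norm_num) _).le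
  have hs8 : s ≤ 8 := hs.2.trans hτ₁8
  have hincr : Real.sqrt 2 / 2 * ((1 + 1 : ℝ) ^ ((5 : ℝ) * (((4 - 1 : ℤ) : ℝ)) / 2) *
      (65 / 32 * (6 / 10 ^ 20))) * s ≤ 13 / 10 ^ 17 := by
    have h1 : Real.sqrt 2 / 2 * ((1 + 1 : ℝ) ^ ((5 : ℝ) * (((4 - 1 : ℤ) : ℝ)) / 2) *
        (65 / 32 * (6 / 10 ^ 20))) ≤ 14143 / 10000 / 2 * (1811 / 10 * (65 / 32 * (6 / 10 ^ 20))) := by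
      have := sqrt_two_le
      have h0 : 0 ≤ Real.sqrt 2 := Real.sqrt_nonneg 2
      nlinarith
    have h2 : 0 ≤ Real.sqrt 2 / 2 * ((1 + 1 : ℝ) ^ ((5 : ℝ) * (((4 - 1 : ℤ) : ℝ)) / 2) *
        (65 / 32 * (6 / 10 ^ 20))) := by positivity
    nlinarith
  have hE := two_sqrt_est_four_ge
  have hroot : Real.sqrt (∑ i, F i 4 s) ≤ 3 * Real.sqrt (2 * (3 * aheadE 4 + idleE 4)) := by
    linarith
  have hnn : 0 ≤ ∑ i, F i 4 s := Finset.sum_nonneg fun i _ => h.nonneg_F i 4 s (hsub hs)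
  have hE0 := est_nonneg 4
  calc ∑ i, F i 4 s = Real.sqrt (∑ i, F i 4 s) ^ 2 := (Real.sq_sqrt hnn).symm
    _ ≤ (3 * Real.sqrt (2 * (3 * aheadE 4 + idleE 4))) ^ 2 :=
        pow_le_pow_left₀ (Real.sqrt_nonneg _) hroot 2
    _ = 9 * (2 * (3 * aheadE 4 + idleE 4)) := by
        rw [mul_pow, Real.sq_sqrt hE0]; ring

/-- **One shell further out** (step of the induction, `K ≥ 4`): if `Σᵢ F_{i,K} ≤ 9·Est K` on `[0, τ₁]`
then `Σᵢ F_{i,K+1} ≤ 9·Est(K+1)` on `[0, τ₁]` (`τ₁ ≤ 8`), by the relay tail step driven by the previous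
shell's energy and `2^{5K/2}·P K ≤ 2^{−26}`. [this file] -/
theorem shell_succ_le (h : PseudoFlowOn τ 1 α κ₁ κ₂ S₀ F₀ B₀ S F) (hτ : 0 < τ)
    (hα : IsCancellingCoeff α) (hrows : RelayRows α)
    (hahead : ∀ k : ℤ, 2 ≤ k → ∀ i : Fin 4, i ≠ 3 → F₀ i k ≤ aheadE k)
    (hidle : ∀ k : ℤ, F₀ 3 k ≤ idleE k) {τ₁ : ℝ} (hτ₁ : τ₁ ∈ Icc 0 τ) (hτ₁8 : τ₁ ≤ 8)
    {K : ℤ} (hK : 4 ≤ K) (ih : ∀ s ∈ Icc 0 τ₁, ∑ i, F i K s ≤ 9 * (2 * (3 * aheadE K + idleE K))) :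
    ∀ s ∈ Icc 0 τ₁, ∑ i, F i (K + 1) s ≤ 9 * (2 * (3 * aheadE (K + 1) + idleE (K + 1))) := by
  have hsub : Icc 0 τ₁ ⊆ Icc 0 τ := Icc_subset_Icc_right hτ₁.2
  intro s hs
  have hK2 : 2 ≤ K + 1 := by omega
  have hstep := relay_tail_step_of_energy_le h hτ hα hrows (K + 1) (est_nonneg (K + 1))
    (tail_start_le hahead hidle hK2) hτ₁ (β := 9 * (2 * (3 * aheadE K + idleE K)))
    (fun u hu => by rw [add_sub_cancel_right]; exact ih u hu) s hs
  -- the clock at shell K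
  have hcast : (5 : ℝ) * (((K + 1 - 1 : ℤ) : ℝ)) / 2 = (5 : ℝ) * (K : ℝ) / 2 := by push_cast; ring
  rw [hcast] at hstep
  set P : ℝ := (2 : ℝ) ^ (-(12 : ℝ) * ((K : ℝ) - 1)) with hPdef
  have hP : 0 < P := Real.rpow_pos_of_pos (by norm_num) _
  have hΛP := clock_mul_P_le hK
  have hΛ0 : 0 ≤ (1 + 1 : ℝ) ^ ((5 : ℝ) * (K : ℝ) / 2) := (Real.rpow_pos_of_pos (by norm_num) _).le
  have hEst : 2 * (3 * aheadE K + idleE K) =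
      (2 * (3 * ((1 / 2) * ((5 / 10 ^ 10) * 4096) ^ 2) + (1 / 2) * (1 / 10 ^ 10))) * P ^ 2 :=
    est_eq (by omega)
  have hs8 : s ≤ 8 := hs.2.trans hτ₁8
  -- increment ≤ 2·(1e-5 · P(K+1)) ≤ 2 √(Est (K+1))
  have hlow : (1 / 10 ^ 5) * ((1 / 4096) * P) ≤ Real.sqrt (2 * (3 * aheadE (K + 1) + idleE (K + 1))) := by
    have := sqrt_est_ge hK2
    rwa [P_succ] at this
  have hincr : Real.sqrt 2 / 2 * ((1 + 1 : ℝ) ^ ((5 : ℝ) * (K : ℝ) / 2) *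
      (65 / 32 * (9 * (2 * (3 * aheadE K + idleE K))))) * s ≤
      2 * ((1 / 10 ^ 5) * ((1 / 4096) * P)) := by
    rw [hEst]
    -- Λ·P² ≤ 2^{-26}·P
    have h1 : (1 + 1 : ℝ) ^ ((5 : ℝ) * (K : ℝ) / 2) * P ^ 2 ≤ 1 / 2 ^ 26 * P := by
      have := mul_le_mul_of_nonneg_right hΛP hP.le
      calc (1 + 1 : ℝ) ^ ((5 : ℝ) * (K : ℝ) / 2) * P ^ 2
          = (1 + 1 : ℝ) ^ ((5 : ℝ) * (K : ℝ) / 2) * P * P := by ring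
        _ ≤ 1 / 2 ^ 26 * P := this
    have h2 : 0 ≤ Real.sqrt 2 := Real.sqrt_nonneg 2
    have h3 := sqrt_two_le
    have h4 : 0 ≤ (1 + 1 : ℝ) ^ ((5 : ℝ) * (K : ℝ) / 2) * P ^ 2 := by positivity
    nlinarith [mul_nonneg h2 h4, mul_nonneg h2 hP.le]
  have hroot : Real.sqrt (∑ i, F i (K + 1) s) ≤
      3 * Real.sqrt (2 * (3 * aheadE (K + 1) + idleE (K + 1))) := by linarith
  have hnn : 0 ≤ ∑ i, F i (K + 1) s := Finset.sum_nonneg fun i _ => h.nonneg_F i (K + 1) s (hsub hs)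
  have hE0 := est_nonneg (K + 1)
  calc ∑ i, F i (K + 1) s = Real.sqrt (∑ i, F i (K + 1) s) ^ 2 := (Real.sq_sqrt hnn).symm
    _ ≤ (3 * Real.sqrt (2 * (3 * aheadE (K + 1) + idleE (K + 1)))) ^ 2 :=
        pow_le_pow_left₀ (Real.sqrt_nonneg _) hroot 2
    _ = 9 * (2 * (3 * aheadE (K + 1) + idleE (K + 1))) := by
        rw [mul_pow, Real.sq_sqrt hE0]; ring

/-- **Old shells `K ≥ 4` over the hop**: `Σᵢ F_{i,K}(s) ≤ 9·Est K` on `[0, τ₁]` (`τ₁ ≤ 8`), by induction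
on `K` (`shell_four_le`, `shell_succ_le`). [this file] -/
theorem shell_ge_four_le (h : PseudoFlowOn τ 1 α κ₁ κ₂ S₀ F₀ B₀ S F) (hτ : 0 < τ)
    (hα : IsCancellingCoeff α) (hrows : RelayRows α)
    (hahead : ∀ k : ℤ, 2 ≤ k → ∀ i : Fin 4, i ≠ 3 → F₀ i k ≤ aheadE k)
    (hidle : ∀ k : ℤ, F₀ 3 k ≤ idleE k) {τ₁ : ℝ} (hτ₁ : τ₁ ∈ Icc 0 τ) (hτ₁8 : τ₁ ≤ 8)
    (h3 : ∀ s ∈ Icc 0 τ₁, ∑ i, F i 3 s ≤ 6 / 10 ^ 20) :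
    ∀ K : ℤ, 4 ≤ K → ∀ s ∈ Icc 0 τ₁, ∑ i, F i K s ≤ 9 * (2 * (3 * aheadE K + idleE K)) := by
  intro K hK
  obtain ⟨n, rfl⟩ : ∃ n : ℕ, K = 4 + n := ⟨(K - 4).toNat, by omega⟩
  induction n with
  | zero =>
    simpa using shell_four_le h hτ hα hrows hahead hidle hτ₁ hτ₁8 h3
  | succ n ih =>
    have hstep := shell_succ_le h hτ hα hrows hahead hidle hτ₁ hτ₁8 (K := 4 + n) (by omega)
      (ih (by omega))
    rw [show (4 + ((n + 1 : ℕ) : ℤ) : ℤ) = 4 + (n : ℤ) + 1 by push_cast; ring]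
    exact hstep

/-! ### The registered stub -/

/-- **Registered stub `stub_tail` of LINE `window_v2` (crux `RelayFrontStep`,
stmt-NavierStokesRegularity-24850), verbatim.** THE FAR TAIL: along any `(1e-8, 1e-8)`-pseudo-flow of a
table in `E₂(64)` with the completion-relay rows, started with the far-ahead and idle energy clauses of
`W₂`, and given the time-integrated relay-flux weight of old shell 2 on the hop window `[0, τ₁]`
(`τ₁ ≤ 8`), the energies of all old shells `k ≥ 4` (non-idle modes) stay under `relayEnv₂` and the
far-ahead energy clauses re-enter after rescaling by any amplitude ratio `a ≥ 17/20`. [this file] -/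
theorem stub_tail :
  ∀ α : Fin 4 → Fin 4 → Fin 4 → ℤ × ℤ × ℤ → ℝ, InTableClass 64 α → RelayRows α →
    ∀ (τ : ℝ) (S₀ F₀ B₀ : Fin 4 → ℤ → ℝ) (S F : Fin 4 → ℤ → ℝ → ℝ), 0 < τ →
      PseudoFlowOn τ 1 α (1 / 10 ^ 8) (1 / 10 ^ 8) S₀ F₀ B₀ S F →
      (∀ k : ℤ, 2 ≤ k → ∀ i : Fin 4, i ≠ 3 → F₀ i k ≤ aheadE k) →
      (∀ k : ℤ, F₀ 3 k ≤ idleE k) →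
      ∀ τ₁ ∈ Icc (0 : ℝ) τ, τ₁ ≤ 8 →
        (∀ s ∈ Icc (0 : ℝ) τ₁, |S 1 2 s| ≤ 2 / 10 ^ 6 ∧ |S 2 2 s| ≤ 1 / 10 ^ 8) →
        (∫ s in (0 : ℝ)..τ₁, S 1 2 s ^ 2) ≤ 1 / 10 ^ 11 →
        (∫ s in (0 : ℝ)..τ₁, |S 2 2 s * S 1 2 s|) ≤ 1 / 10 ^ 13 →
        (∀ s ∈ Icc (0 : ℝ) τ₁, ∀ (i : Fin 4) (k : ℤ), 4 ≤ k → i ≠ 3 → F i k s ≤ relayEnv₂ k) ∧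
        ∀ a : ℝ, 17 / 20 ≤ a →
          ∀ k : ℤ, 3 ≤ k → ∀ i : Fin 4, i ≠ 3 → F i (1 + k) τ₁ / a ^ 2 ≤ aheadE k := by
  intro α hE hrows τ S₀ F₀ B₀ S F hτ hflow hahead hidle τ₁ hτ₁ hτ₁8 _hUR hI1 hI2
  have hα : IsCancellingCoeff α := hE.2.1
  have hsub : Icc 0 τ₁ ⊆ Icc 0 τ := Icc_subset_Icc_right hτ₁.2
  have h3 := shell_three_le hflow hτ hα hrows hahead hidle hτ₁ hI1 hI2
  have hK := shell_ge_four_le hflow hτ hα hrows hahead hidle hτ₁ hτ₁8 h3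
  -- a single non-idle energy is below the shell's total energy
  have hsingle : ∀ (i : Fin 4) (k : ℤ), ∀ s ∈ Icc 0 τ₁, F i k s ≤ ∑ j, F j k s :=
    fun i k s hs => Finset.single_le_sum (f := fun j => F j k s)
      (fun j _ => hflow.nonneg_F j k s (hsub hs)) (Finset.mem_univ i)
  refine ⟨?_, ?_⟩
  · -- envelope for old shells k ≥ 4
    intro s hs i k hk _
    have h1 := (hsingle i k s hs).trans (hK k hk s hs)
    refine h1.trans ?_
    rw [est_eq (by omega), relayEnv₂_eq (by omega)]
    nlinarith [sq_nonneg ((2 : ℝ) ^ (-(12 : ℝ) * ((k : ℝ) - 1)))]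
  · -- landing of the far-ahead clauses, new offsets k ≥ 3 (old shells 1 + k ≥ 4)
    intro a ha k hk i _
    have hτ₁mem : τ₁ ∈ Icc 0 τ₁ := ⟨hτ₁.1, le_rfl⟩
    have h1 := (hsingle i (1 + k) τ₁ hτ₁mem).trans (hK (1 + k) (by omega) τ₁ hτ₁mem)
    have ha2 : 289 / 400 ≤ a ^ 2 := by nlinarith
    have hapos : 0 < a ^ 2 := by positivity
    rw [div_le_iff₀ hapos]
    refine h1.trans ?_
    rw [est_eq (by omega), P_one_add, aheadE_eq]
    have hP : 0 ≤ ((2 : ℝ) ^ (-(12 : ℝ) * ((k : ℝ) - 1))) ^ 2 := sq_nonneg _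
    nlinarith


/-- **`stub_tail` from the time-integrated bounds alone** (LINE `window_v2`, reshape v2d of `stub_front`): the
far-tail conclusions of `stub_tail` need only `∫u₂² ≤ 1e-11` and `∫|r₂u₂| ≤ 1e-13` on the hop window — the sup
bounds `|u₂| ≤ 2e-6`, `|r₂| ≤ 1e-8` of the registered signature are NOT used (critic idea-crit-3 N1: that clause was
the thinnest margin of the front block, numerics `sup u₂ = 1.55e-6`; it is now dropped from `stub_front`). Same
proof as `stub_tail`. MODEL lattice; nothing about the Navier–Stokes equations. [this file] -/
theorem stub_tail_int :
  ∀ α : Fin 4 → Fin 4 → Fin 4 → ℤ × ℤ × ℤ → ℝ, InTableClass 64 α → RelayRows α →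
    ∀ (τ : ℝ) (S₀ F₀ B₀ : Fin 4 → ℤ → ℝ) (S F : Fin 4 → ℤ → ℝ → ℝ), 0 < τ →
      PseudoFlowOn τ 1 α (1 / 10 ^ 8) (1 / 10 ^ 8) S₀ F₀ B₀ S F →
      (∀ k : ℤ, 2 ≤ k → ∀ i : Fin 4, i ≠ 3 → F₀ i k ≤ aheadE k) →
      (∀ k : ℤ, F₀ 3 k ≤ idleE k) →
      ∀ τ₁ ∈ Icc (0 : ℝ) τ, τ₁ ≤ 8 →
        (∫ s in (0 : ℝ)..τ₁, S 1 2 s ^ 2) ≤ 1 / 10 ^ 11 →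
        (∫ s in (0 : ℝ)..τ₁, |S 2 2 s * S 1 2 s|) ≤ 1 / 10 ^ 13 →
        (∀ s ∈ Icc (0 : ℝ) τ₁, ∑ i, F i 3 s ≤ 6 / 10 ^ 20) ∧
        (∀ s ∈ Icc (0 : ℝ) τ₁, ∀ (i : Fin 4) (k : ℤ), 3 ≤ k → i ≠ 3 → F i k s ≤ relayEnv₂ k) ∧
        ∀ a : ℝ, 17 / 20 ≤ a →
          ∀ k : ℤ, 3 ≤ k → ∀ i : Fin 4, i ≠ 3 → F i (1 + k) τ₁ / a ^ 2 ≤ aheadE k := by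
  intro α hE hrows τ S₀ F₀ B₀ S F hτ hflow hahead hidle τ₁ hτ₁ hτ₁8 hI1 hI2
  have hα : IsCancellingCoeff α := hE.2.1
  have hsub : Icc 0 τ₁ ⊆ Icc 0 τ := Icc_subset_Icc_right hτ₁.2
  have h3 := shell_three_le hflow hτ hα hrows hahead hidle hτ₁ hI1 hI2
  have hK := shell_ge_four_le hflow hτ hα hrows hahead hidle hτ₁ hτ₁8 h3
  -- a single non-idle energy is below the shell's total energy
  have hsingle : ∀ (i : Fin 4) (k : ℤ), ∀ s ∈ Icc 0 τ₁, F i k s ≤ ∑ j, F j k s :=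
    fun i k s hs => Finset.single_le_sum (f := fun j => F j k s)
      (fun j _ => hflow.nonneg_F j k s (hsub hs)) (Finset.mem_univ i)
  refine ⟨h3, ?_, ?_⟩
  · -- envelope for old shells k ≥ 3 (shell 3 from `shell_three_le`, k ≥ 4 as in `stub_tail`)
    intro s hs i k hk _
    by_cases hk3 : k = 3
    · subst hk3
      have h1 := (hsingle i 3 s hs).trans (h3 s hs)
      refine h1.trans ?_
      rw [relayEnv₂_eq (by norm_num), P_three]
      norm_num
    have hk4 : 4 ≤ k := by omega
    have h1 := (hsingle i k s hs).trans (hK k hk4 s hs)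
    refine h1.trans ?_
    rw [est_eq (by omega), relayEnv₂_eq (by omega)]
    nlinarith [sq_nonneg ((2 : ℝ) ^ (-(12 : ℝ) * ((k : ℝ) - 1)))]
  · -- landing of the far-ahead clauses, new offsets k ≥ 3 (old shells 1 + k ≥ 4)
    intro a ha k hk i _
    have hτ₁mem : τ₁ ∈ Icc 0 τ₁ := ⟨hτ₁.1, le_rfl⟩
    have h1 := (hsingle i (1 + k) τ₁ hτ₁mem).trans (hK (1 + k) (by omega) τ₁ hτ₁mem)
    have ha2 : 289 / 400 ≤ a ^ 2 := by nlinarith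
    have hapos : 0 < a ^ 2 := by positivity
    rw [div_le_iff₀ hapos]
    refine h1.trans ?_
    rw [est_eq (by omega), P_one_add, aheadE_eq]
    have hP : 0 ≤ ((2 : ℝ) ^ (-(12 : ℝ) * ((k : ℝ) - 1))) ^ 2 := sq_nonneg _
    nlinarith

end Summit.NavierStokesRegularity.NavierStokesRegularity.Cruxes.RelayFrontStep.Window2
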